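import Mathlib
import Summits.Ventures.PercRepro2.Defs
import Summits.Ventures.PercRepro2.Graph
import Summits.Ventures.PercRepro2.OneColourSwitch
import Summits.Ventures.PercRepro2.RegionHubSign
import Summits.Ventures.PercRepro2.SideSwitch
import Summits.Ventures.PercRepro2.SideSwitchComps
import Summits.Ventures.PercRepro2.SideSwitchM9
import Summits.Ventures.PercRepro2.TermSwitchDefs
import Summits.Ventures.PercRepro2.TermSwitchFibre
import Summits.Ventures.PercRepro2.TermSwitchCompsFibre
import Summits.Ventures.PercRepro2.TermSwitchMono
import Summits.Ventures.PercRepro2.TermSwitchM9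
import Summits.Ventures.PercRepro2.TermSwitchRestrict
import Summits.Ventures.PercRepro2.M9NoPocketDefs
import Summits.Ventures.PercRepro2.M9YSliceDefs
import Summits.Ventures.PercRepro2.M9YSliceOD
import Summits.Ventures.PercRepro2.M9YSliceOF
import Summits.Ventures.PercRepro2.M9YSliceOP
import Summits.Ventures.PercRepro2.M9LoopRS
import Summits.Ventures.PercRepro2.M9YSliceK
import Summits.Ventures.PercRepro2.M9DegreeThreeTransfer
import Summits.Ventures.PercRepro2.M9DegreeThree

/-!
# The unreached half of the `Y`-slice, Theorem Y, and the degree-three class (blind cell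
PercRepro2, p3 g26, 2026-08-28; `proofs/P3-YSLICE.md` §1, §3(O) part 4)

`ySliceO ≤ 0` (`ySliceO_nonpos`, no `r–s` edges): the unreached half is the sum over the slice
representatives of `G − d` of the kernel `oker` along their fibres (`ySliceO_eq_sum_oker`,
`sum_dzeroH_eq_sum_repH_comps`); the representatives outside the slice contribute nothing, the
involution `φ` pairs the others, and the paired kernel along a fibre is the sub-cube kernel of
`M9YSliceOP` (`pair_oker_eq`, after reindexing the assignments containing `N` by the cube
`2^{A ∖ N}`: `sum_powerset_superset`), which sums to `≤ 0` (`pair_sum_nonpos`).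

**Theorem Y** (`ySlice_nonpos`): for every finite multigraph without `r–s` edges and every
non-mark `d`, the `Y`-slice of the single-`d` sum is non-positive,
`Σ_{Sep ∧ DOne(d), every edge at d is Y} σ_pq · σ_rs ≤ 0` — the two halves `ySliceK_nonpos`
(`M9YSliceK`) and `ySliceO_nonpos`.

**Class C3** (`dSignSum_nonpos_of_degree_three`): a non-mark `d` carrying exactly three non-loop
edges has `Σ_{Sep ∧ DOne(d)} σ_pq · σ_rs ≤ 0`, for every finite multigraph: the degree-three
identity (`M9DegreeThree`) with Theorem Y when there is no `r–s` edge, and the lane's looping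
identity `dSignSum_loop_rs` (an `r–s` edge looped doubles the sum) to remove the `r–s` edges one
by one (`dSignSum_nonpos_of_degree_three_nors` is the `r–s`-free case; `r = s` is trivial).
C3 is the first class in which `d` can be doubly reached through two non-adjacent rooted
neighbours and still carry a third edge.  Own work; std axioms.
-/

namespace Summit.Ventures.PercRepro2

namespace NoPocket

open Finset Classical RegionHub OneColourSwitch SideSwitch TermSwitch

variable {V : Type*} {E : Type*}
variable [Fintype V] [DecidableEq V] [Fintype E] [DecidableEq E]

section Main

variable {ends : E → Sym2 V}

omit [Fintype V] [Fintype E] [DecidableEq E] in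
/-- Reindexing a sum over the super-sets of `N` in `A` by the cube `2^{A ∖ N}`. -/
lemma sum_powerset_superset {A N : Finset (Finset V)} (hNA : N ⊆ A) (f : Finset (Finset V) → ℤ) :
    ∑ T ∈ A.powerset, (if N ⊆ T then f T else 0) = ∑ T' ∈ (A \ N).powerset, f (N ∪ T') := by
  rw [← Finset.sum_filter]
  refine Finset.sum_nbij' (fun T => T \ N) (fun T' => N ∪ T') ?_ ?_ ?_ ?_ ?_
  · intro T hT
    rw [Finset.mem_filter, Finset.mem_powerset] at hT
    exact Finset.mem_powerset.2 (Finset.sdiff_subset_sdiff hT.1 (Finset.Subset.refl N))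
  · intro T' hT'
    rw [Finset.mem_powerset] at hT'
    rw [Finset.mem_filter, Finset.mem_powerset]
    exact ⟨Finset.union_subset hNA (hT'.trans Finset.sdiff_subset), Finset.subset_union_left⟩
  · intro T hT
    rw [Finset.mem_filter] at hT
    exact Finset.union_sdiff_of_subset hT.2
  · intro T' hT'
    rw [Finset.mem_powerset] at hT'
    exact Finset.union_sdiff_cancel_left (Finset.disjoint_sdiff.mono_right hT')
  · intro T hT
    rw [Finset.mem_filter] at hT
    rw [Finset.union_sdiff_of_subset hT.2]

/-- **The paired kernel along a fibre is the sub-cube kernel.** -/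
lemma pair_oker_eq {p q r s d : V} (hr : d ≠ r) (hs : d ≠ s) {ρ : Config E}
    (hρ : ρ ∈ RepH (endsD ends d) p q ({r, s} : Set V)) (hY : StarY ends d ρ)
    (hH : NoNbH ends r s d) :
    ∑ T ∈ (compsH (endsD ends d) ({r, s} : Set V) ρ).powerset,
      (oker ends p q r s d (assignC (endsD ends d) T ρ) +
        oker ends p q r s d (assignC (endsD ends d) T (phiO ends r s d ρ))) =
    ∑ T' ∈ (compsH (endsD ends d) ({r, s} : Set V) ρ \ nbComps ends r s d ρ).powerset,
      (gPlus ends p q r s d ρ (nbComps ends r s d ρ) T' -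
        gMinus ends p q r s d ρ (compsH (endsD ends d) ({r, s} : Set V) ρ \
          (nbComps ends r s d ρ ∪ T'))) *
        sK ends r s d ρ (nbComps ends r s d ρ) T' := by
  have hρ' : phiO ends r s d ρ ∈ RepH (endsD ends d) p q ({r, s} : Set V) := phiO_mem_RepH hρ
  have hY' : StarY ends d (phiO ends r s d ρ) := starY_phiO r s d ρ
  have hNA : nbComps ends r s d ρ ⊆ compsH (endsD ends d) ({r, s} : Set V) ρ :=
    Finset.filter_subset _ _
  -- the summand at `T`
  have hT : ∀ T ∈ (compsH (endsD ends d) ({r, s} : Set V) ρ).powerset,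
      oker ends p q r s d (assignC (endsD ends d) T ρ) +
        oker ends p q r s d (assignC (endsD ends d) T (phiO ends r s d ρ)) =
      if nbComps ends r s d ρ ⊆ T then
        (gPlus ends p q r s d ρ T ∅ - gMinus ends p q r s d ρ
          (compsH (endsD ends d) ({r, s} : Set V) ρ \ T)) * sK ends r s d ρ T ∅
      else 0 := by
    intro T hT
    have hT := Finset.mem_powerset.1 hT
    have hT' : T ⊆ compsH (endsD ends d) ({r, s} : Set V) (phiO ends r s d ρ) := by
      rw [compsH_phiO]; exact hT
    rw [oker_assignC hr hs hρ hT, oker_assignC hr hs hρ' hT', nbComps_phiO]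
    by_cases hN : nbComps ends r s d ρ ⊆ T
    · rw [if_pos (show StarY ends d ρ ∧ NoNbH ends r s d ∧ nbComps ends r s d ρ ⊆ T from
          ⟨hY, hH, hN⟩),
        if_pos (show StarY ends d (phiO ends r s d ρ) ∧ NoNbH ends r s d ∧
          nbComps ends r s d ρ ⊆ T from ⟨hY', hH, hN⟩), if_pos hN]
      have hc := conn_pq_compl_assignC_phiO hρ hT
      have hS := sigma_rs_assignC_phiO hρ hT
      unfold gPlus gMinus sK
      rw [Finset.union_empty, hS]
      simp only [hc.1, hc.2]
      ring
    · rw [if_neg (fun h => hN h.2.2), if_neg (fun h => hN h.2.2), if_neg hN, add_zero]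
  refine (Finset.sum_congr rfl hT).trans ?_
  refine (sum_powerset_superset hNA (fun T => (gPlus ends p q r s d ρ T ∅ -
    gMinus ends p q r s d ρ (compsH (endsD ends d) ({r, s} : Set V) ρ \ T)) *
      sK ends r s d ρ T ∅)).trans ?_
  refine Finset.sum_congr rfl (fun T' _ => ?_)
  show (gPlus ends p q r s d ρ (nbComps ends r s d ρ ∪ T') ∅ -
    gMinus ends p q r s d ρ (compsH (endsD ends d) ({r, s} : Set V) ρ \
      (nbComps ends r s d ρ ∪ T'))) * sK ends r s d ρ (nbComps ends r s d ρ ∪ T') ∅ = _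
  unfold gPlus gMinus sK
  rw [Finset.union_empty]

/-- **The unreached half of the `Y`-slice is non-positive** (no `r–s` edges): every non-mark `d`
has `Σ_{Sep ∧ DOne(d), every edge at d is Y, d ∉ K₂} σ_pq · σ_rs ≤ 0`. -/
theorem ySliceO_nonpos {p q r s d : V} (hr : d ≠ r) (hs : d ≠ s) (hp : p ≠ d)
    (hrs : ∀ e, ends e ≠ s(r, s)) : ySliceO ends p q r s d ≤ 0 := by
  rw [ySliceO_eq_sum_oker hr hs hp, sum_dzeroH_eq_sum_repH_comps (oker ends p q r s d)]
  set Ψ : Config E → ℤ := fun ρ => ∑ T ∈ (compsH (endsD ends d) ({r, s} : Set V) ρ).powerset,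
    oker ends p q r s d (assignC (endsD ends d) T ρ) with hΨ
  show ∑ ρ ∈ RepH (endsD ends d) p q ({r, s} : Set V), Ψ ρ ≤ 0
  -- representatives outside the slice contribute nothing
  have hzero : ∀ ρ ∈ RepH (endsD ends d) p q ({r, s} : Set V), ¬ StarY ends d ρ → Ψ ρ = 0 := by
    intro ρ hρ hY
    refine Finset.sum_eq_zero (fun T hT => ?_)
    rw [oker_assignC hr hs hρ (Finset.mem_powerset.1 hT)]
    exact if_neg (fun h => hY h.1)
  have hfilt : ∑ ρ ∈ RepH (endsD ends d) p q ({r, s} : Set V), Ψ ρ =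
      ∑ ρ ∈ (RepH (endsD ends d) p q ({r, s} : Set V)).filter (fun ρ => StarY ends d ρ), Ψ ρ := by
    rw [Finset.sum_filter]
    refine Finset.sum_congr rfl (fun ρ hρ => ?_)
    by_cases hY : StarY ends d ρ
    · rw [if_pos hY]
    · rw [if_neg hY, hzero ρ hρ hY]
  rw [hfilt]
  -- the pairing `ρ ↔ φρ` on the slice representatives
  have hO : ∑ ρ ∈ (RepH (endsD ends d) p q ({r, s} : Set V)).filter (fun ρ => StarY ends d ρ),
      Ψ ρ = ∑ ρ ∈ (RepH (endsD ends d) p q ({r, s} : Set V)).filter (fun ρ => StarY ends d ρ),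
        Ψ (phiO ends r s d ρ) := by
    symm
    refine Finset.sum_nbij' (fun ρ => phiO ends r s d ρ) (fun ρ => phiO ends r s d ρ) ?_ ?_ ?_ ?_
      (fun ρ _ => rfl)
    · intro ρ hρ
      rw [Finset.mem_filter] at hρ ⊢
      exact ⟨phiO_mem_RepH hρ.1, starY_phiO r s d ρ⟩
    · intro ρ hρ
      rw [Finset.mem_filter] at hρ ⊢
      exact ⟨phiO_mem_RepH hρ.1, starY_phiO r s d ρ⟩
    · intro ρ hρ
      rw [Finset.mem_filter] at hρ
      exact phiO_phiO hρ.2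
    · intro ρ hρ
      rw [Finset.mem_filter] at hρ
      exact phiO_phiO hρ.2
  have htwice : 2 * ∑ ρ ∈ (RepH (endsD ends d) p q ({r, s} : Set V)).filter
      (fun ρ => StarY ends d ρ), Ψ ρ ≤ 0 := by
    have hsum : 2 * ∑ ρ ∈ (RepH (endsD ends d) p q ({r, s} : Set V)).filter
        (fun ρ => StarY ends d ρ), Ψ ρ =
        ∑ ρ ∈ (RepH (endsD ends d) p q ({r, s} : Set V)).filter (fun ρ => StarY ends d ρ),
          (Ψ ρ + Ψ (phiO ends r s d ρ)) := by
      rw [Finset.sum_add_distrib, ← hO]; ring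
    rw [hsum]
    refine Finset.sum_nonpos (fun ρ hρ => ?_)
    rw [Finset.mem_filter] at hρ
    obtain ⟨hρ, hY⟩ := hρ
    have hpair : Ψ ρ + Ψ (phiO ends r s d ρ) =
        ∑ T ∈ (compsH (endsD ends d) ({r, s} : Set V) ρ).powerset,
          (oker ends p q r s d (assignC (endsD ends d) T ρ) +
            oker ends p q r s d (assignC (endsD ends d) T (phiO ends r s d ρ))) := by
      simp only [hΨ, compsH_phiO]
      rw [Finset.sum_add_distrib]
    rw [hpair]
    by_cases hH : NoNbH ends r s d
    · rw [pair_oker_eq hr hs hρ hY hH]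
      exact pair_sum_nonpos hr hs hrs hρ hY hH
    · refine le_of_eq (Finset.sum_eq_zero (fun T hT => ?_))
      have hT := Finset.mem_powerset.1 hT
      have hT' : T ⊆ compsH (endsD ends d) ({r, s} : Set V) (phiO ends r s d ρ) := by
        rw [compsH_phiO]; exact hT
      rw [oker_assignC hr hs hρ hT, oker_assignC hr hs (phiO_mem_RepH hρ) hT',
        if_neg (fun h => hH h.2.1), if_neg (fun h => hH h.2.1), add_zero]
  linarith

end Main


section Class

variable {ends : E → Sym2 V}

/-- **Theorem Y — the `Y`-slice is non-positive** (no `r–s` edges): for every non-mark `d`,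
`Σ_{Sep ∧ DOne(d), every edge at d is Y} σ_pq · σ_rs ≤ 0`. -/
theorem ySlice_nonpos {p q r s d : V} (hr : d ≠ r) (hs : d ≠ s) (hp : p ≠ d)
    (hrs : ∀ e, ends e ≠ s(r, s)) : ySlice ends p q r s d ≤ 0 := by
  rw [ySlice_eq_add]
  linarith [ySliceK_nonpos (ends := ends) (p := p) (q := q) hr hs hrs,
    ySliceO_nonpos (ends := ends) (q := q) hr hs hp hrs]

/-- **The degree-three class without `r–s` edges.** -/
theorem dSignSum_nonpos_of_degree_three_nors {p q r s : V} {e₁ e₂ e₃ : E} {d x₁ x₂ x₃ : V}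
    (h12 : e₁ ≠ e₂) (h13 : e₁ ≠ e₃) (h23 : e₂ ≠ e₃)
    (hd : ∀ e, d ∈ ends e → ¬ (ends e).IsDiag → e = e₁ ∨ e = e₂ ∨ e = e₃)
    (h₁ : ends e₁ = s(d, x₁)) (h₂ : ends e₂ = s(d, x₂)) (h₃ : ends e₃ = s(d, x₃))
    (hx₁ : x₁ ≠ d) (hx₂ : x₂ ≠ d) (hx₃ : x₃ ≠ d)
    (hp : p ≠ d) (hq : q ≠ d) (hr : r ≠ d) (hs : s ≠ d) (hrs : ∀ e, ends e ≠ s(r, s)) :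
    dSignSum ends p q r s d ≤ 0 :=
  dSignSum_nonpos_of_degree_three_of_ySlice h12 h13 h23 hd h₁ h₂ h₃ hx₁ hx₂ hx₃ hp hq hr hs
    (ySlice_nonpos hr.symm hs.symm hp hrs)

omit [Fintype V] [DecidableEq V] in
/-- The single-`d` sum vanishes when `r = s`. -/
lemma dSignSum_self (p q r d : V) : dSignSum ends p q r r d = 0 := by
  unfold dSignSum
  refine Finset.sum_eq_zero (fun ω _ => ?_)
  have h : sigma ends ω r r = 0 := by
    simp [sigma, conn_refl]
  rw [h, mul_zero, ite_self]

omit [Fintype V] [DecidableEq V] [Fintype E] [DecidableEq E] in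
/-- An edge at `d` is not an `r–s` edge. -/
lemma ne_of_ends_d {r s d x : V} {e : E} (hr : r ≠ d) (hs : s ≠ d) (he : ends e = s(d, x)) :
    ends e ≠ s(r, s) := by
  intro h
  rw [he, Sym2.eq_iff] at h
  rcases h with ⟨h, _⟩ | ⟨h, _⟩
  · exact hr h.symm
  · exact hs h.symm

/-- **CLASS C3 — the degree-three class**: a non-mark `d` with exactly three non-loop edges has
`Σ_{Sep ∧ DOne(d)} σ_pq · σ_rs ≤ 0` on every finite multigraph. -/
theorem dSignSum_nonpos_of_degree_three {p q r s : V} {e₁ e₂ e₃ : E} {d x₁ x₂ x₃ : V}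
    (h12 : e₁ ≠ e₂) (h13 : e₁ ≠ e₃) (h23 : e₂ ≠ e₃)
    (hd : ∀ e, d ∈ ends e → ¬ (ends e).IsDiag → e = e₁ ∨ e = e₂ ∨ e = e₃)
    (h₁ : ends e₁ = s(d, x₁)) (h₂ : ends e₂ = s(d, x₂)) (h₃ : ends e₃ = s(d, x₃))
    (hx₁ : x₁ ≠ d) (hx₂ : x₂ ≠ d) (hx₃ : x₃ ≠ d)
    (hp : p ≠ d) (hq : q ≠ d) (hr : r ≠ d) (hs : s ≠ d) :
    dSignSum ends p q r s d ≤ 0 := by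
  by_cases hrs : r = s
  · subst hrs
    rw [dSignSum_self]
  -- induction on the number of `r–s` edges, looping them one by one
  suffices key : ∀ n : ℕ, ∀ ends : E → Sym2 V,
      (univ.filter (fun e => ends e = s(r, s))).card = n →
      (∀ e, d ∈ ends e → ¬ (ends e).IsDiag → e = e₁ ∨ e = e₂ ∨ e = e₃) →
      ends e₁ = s(d, x₁) → ends e₂ = s(d, x₂) → ends e₃ = s(d, x₃) →
      dSignSum ends p q r s d ≤ 0 from key _ ends rfl hd h₁ h₂ h₃
  intro n
  induction n using Nat.strong_induction_on with
  | _ n ih =>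
    intro ends hn hd h₁ h₂ h₃
    by_cases hex : ∃ e, ends e = s(r, s)
    · obtain ⟨e, he⟩ := hex
      have hloop := dSignSum_loop_rs (p := p) (q := q) (d := d) he
      -- the looped graph has one `r–s` edge fewer and the same star at `d`
      have hmem : e ∈ univ.filter (fun e => ends e = s(r, s)) := by simp [he]
      have hsub : univ.filter (fun e' => loopRS ends r e e' = s(r, s)) ⊆
          (univ.filter (fun e' => ends e' = s(r, s))).erase e := by
        intro e' he'
        rw [Finset.mem_filter] at he'
        have hne : e' ≠ e := by
          rintro rfl
          simp only [loopRS, Function.update_self, Sym2.eq_iff] at he'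
          rcases he'.2 with ⟨_, h⟩ | ⟨h, _⟩ <;> exact hrs h
        rw [Finset.mem_erase, Finset.mem_filter]
        refine ⟨hne, Finset.mem_univ _, ?_⟩
        rw [← he'.2, loopRS, Function.update_of_ne hne]
      have hlt : (univ.filter (fun e' => loopRS ends r e e' = s(r, s))).card < n := by
        have h1 := Finset.card_le_card hsub
        rw [Finset.card_erase_of_mem hmem, hn] at h1
        have hpos : 0 < n := by
          rw [← hn]; exact Finset.card_pos.2 ⟨e, hmem⟩
        omega
      have hd' : ∀ e', d ∈ loopRS ends r e e' → ¬ (loopRS ends r e e').IsDiag →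
          e' = e₁ ∨ e' = e₂ ∨ e' = e₃ := by
        intro e' hde hnd
        by_cases hee : e' = e
        · subst hee
          exact (hnd (loopRS_isDiag)).elim
        · rw [loopRS, Function.update_of_ne hee] at hde hnd
          exact hd e' hde hnd
      have hne₁ : e₁ ≠ e := fun h => ne_of_ends_d hr hs h₁ (h ▸ he)
      have hne₂ : e₂ ≠ e := fun h => ne_of_ends_d hr hs h₂ (h ▸ he)
      have hne₃ : e₃ ≠ e := fun h => ne_of_ends_d hr hs h₃ (h ▸ he)
      have h₁' : loopRS ends r e e₁ = s(d, x₁) := by rw [loopRS, Function.update_of_ne hne₁, h₁]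
      have h₂' : loopRS ends r e e₂ = s(d, x₂) := by rw [loopRS, Function.update_of_ne hne₂, h₂]
      have h₃' : loopRS ends r e e₃ = s(d, x₃) := by rw [loopRS, Function.update_of_ne hne₃, h₃]
      have := ih _ hlt (loopRS ends r e) rfl hd' h₁' h₂' h₃'
      linarith
    · exact dSignSum_nonpos_of_degree_three_nors h12 h13 h23 hd h₁ h₂ h₃ hx₁ hx₂ hx₃ hp hq hr hs
        (fun e h => hex ⟨e, h⟩)

end Class

end NoPocket

end Summit.Ventures.PercRepro2
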